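import Literature.Computability.Cryptography.QuantumCircuit
import Literature.Computability.Cryptography.QubitRegisterProofs
import Literature.Computability.Complexity.TimeBoundsProofs
import HarnessLib

/-!
# Quantum circuits — discharged facts

Proofs of named facts stated in `Literature.Computability.Cryptography.QuantumCircuit` (kept in a
sibling file so that the statement file stays a definitions/named-facts file):

* `QGate.toMatrix_mem_unitaryGroup_holds` and `QCircuit.toMatrix_mem_unitaryGroup_holds`
  discharge the unitarity of placed gates and of circuits over a unitary gate set (placements of
  unitaries are unitary, `placeGate_mem_unitaryGroup_holds`; oracle gates are unitary,
  `oracleGate_mem_unitaryGroup_holds`; products of unitaries are unitary);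
* `normSq_mulVec_of_mem_unitaryGroup`: a unitary matrix preserves the `ℓ²`-norm of a state
  vector, `‖U ψ‖² = ⟨ψ|U†U|ψ⟩ = ‖ψ‖²`;
* `QCircuit.outputPMF_apply_holds` discharges `QCircuit.outputPMF_apply`: the output state
  `U_C |x 0^m⟩` of a circuit over a unitary gate set is a unit vector, so the normalised Born
  distribution `outputPMF` assigns to `y` exactly the squared amplitude `|(U_C |x 0^m⟩)(y)|²`;
* `QCircuit.acceptProb_le_one_holds` discharges `QCircuit.acceptProb_le_one` (a sub-sum of the
  squared amplitudes of a unit vector is at most `1`);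
* `QCircuitFamily.IsUniform.isPolySize_holds` discharges `QCircuitFamily.IsUniform.isPolySize`:
  a polynomial-time uniform family has polynomially many gates and ancillas. The bookkeeping is
  `QCircuit.size_le_length_encode` (every gate contributes at least two bits to `QCircuit.encode`),
  `QCircuit.length_sigmaEncode` / `QCircuit.size_add_le_length_sigmaEncode` (the description
  `sigmaEncode ⟨n, m, C⟩` is at least `C.size + m` bits long, the ancilla count `m` being written
  in unary) and `QCircuitFamily.IsUniform.exists_length_sigmaEncode_le` (a machine halting within
  `p(n)` steps on `1ⁿ` writes at most `n + D·p(n)` output symbols,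
  `Turing.TM2ComputableAux.OutputsWithin.length_le`).

## References

* M. A. Nielsen, I. L. Chuang, *Quantum Computation and Quantum Information*, 10th anniversary
  ed., CUP 2010 (doi:10.1017/cbo9780511976667; page numbers below are PDF pages of the held
  copy): §2.1.6, PDF p. 116 (unitary operators preserve inner products); §2.2.3 Postulate 3,
  eqs. (2.92)–(2.95), PDF p. 131, and §2.2.5 eq. (2.103), PDF p. 134 (Born rule: the outcome
  probabilities of a measurement of a unit vector are `⟨ψ|M_m† M_m|ψ⟩` and sum to one by the
  completeness equation); §4.2–4.3 (circuits are products of placed unitary gates); §6.1.1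
  eq. (6.1), PDF p. 311 (the oracle `|x⟩|q⟩ ↦ |x⟩|q ⊕ f(x)⟩` is a unitary operator); §3.1.2,
  book p. 134 = PDF p. 188 (uniform circuit family: a Turing machine which, upon input of `n`,
  outputs a description of `C_n` — "what gates are in the circuit …, any ancilla bits needed by
  the circuit …"); §4.5.5, book pp. 200–201 = PDF pp. 260–261 (BQP: circuits of polynomial
  size, uniformly generated by a Turing machine "efficiently outputting a description of the
  quantum circuit").
* S. Arora, B. Barak, *Computational Complexity: A Modern Approach*, CUP 2009
  (doi:10.1017/cbo9780511804090): Def. 6.12 and Thm. 6.13, book pp. 111–112 = PDF pp. 140–141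
  (**P**-uniform circuit families: "a polynomial-time TM that on input `1ⁿ` outputs the
  description of the circuit `C_n`"; proof sketch of Thm. 6.13: run `M(1^{|x|})` to obtain
  `C_{|x|}`, a polynomial-time computation); §10.3.5, Def. 10.9, PDF p. 255 (BQP via a
  polynomial-time TM writing the gate descriptions `F_1, …, F_T`, on `m ≤ T(n)` qubits).
* A. C.-C. Yao, *Quantum circuit complexity*, Proc. 34th FOCS (1993), 352–361
  (doi:10.1109/SFCS.1993.366852): uniform polynomial-size quantum circuit families (the source
  cited by the statement file; not held, acquisition request acq-00326).
-/

namespace Literature.Computability.Cryptography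

open Matrix _root_.Computability

variable {G : QGateSet} {n m : ℕ}

/-! ### Gates and circuits over a unitary gate set are unitary -/

/-- **Discharge of `QGate.toMatrix_mem_unitaryGroup`.** The matrix of a placed gate of a unitary
gate set is unitary, for any oracle (placements of unitaries are unitary; oracle gates are
unitary). (Nielsen–Chuang 2010, §4.3, §6.1.1.) [cite: NielsenChuang2010, §4.3] -/
theorem QGate.toMatrix_mem_unitaryGroup_holds :
    QGate.toMatrix_mem_unitaryGroup (G := G) (n := n) := by
  intro hG A g
  cases g with
  | gate g e => exact placeGate_mem_unitaryGroup_holds e (hG g)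
  | oracle k e => exact placeGate_mem_unitaryGroup_holds e (oracleGate_mem_unitaryGroup_holds A k)

/-- **Discharge of `QCircuit.toMatrix_mem_unitaryGroup`.** The matrix of a circuit over a unitary
gate set is unitary, for every oracle: it is a product of unitary gate matrices and the unitary
group is closed under products. (Nielsen–Chuang 2010, §4.2.) [cite: NielsenChuang2010, §4.2] -/
theorem QCircuit.toMatrix_mem_unitaryGroup_holds :
    QCircuit.toMatrix_mem_unitaryGroup (G := G) (n := n) := by
  intro hG A C
  unfold QCircuit.toMatrix
  refine list_prod_mem fun M hM => ?_
  rw [List.mem_reverse, List.mem_map] at hM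
  obtain ⟨g, -, rfl⟩ := hM
  exact QGate.toMatrix_mem_unitaryGroup_holds hG A g

/-! ### Unitaries preserve the norm; the Born rule needs no normalisation -/

/-- The squared norm of a state vector as an inner product: `∑ₓ ‖ψ x‖² = ⟨ψ|ψ⟩ = ψ† ψ`.
(Nielsen–Chuang 2010, §2.1.4.) [folklore] -/
theorem ofReal_normSq_eq_dotProduct {N : ℕ} (ψ : QReg N → ℂ) :
    (normSq ψ : ℂ) = star ψ ⬝ᵥ ψ := by
  simp only [normSq, dotProduct, Pi.star_apply, Complex.star_def, Complex.conj_mul']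
  push_cast
  rfl

/-- **Unitaries preserve the norm.** For a unitary `U`, `∑ ‖(U ψ) y‖² = ∑ ‖ψ y‖²`, since
`⟨Uψ|Uψ⟩ = ⟨ψ|U†U|ψ⟩ = ⟨ψ|ψ⟩`. (Nielsen–Chuang 2010, §2.1.6, PDF p. 116: "unitary operators
... preserve inner products between vectors".) [cite: NielsenChuang2010, §2.1.6] -/
theorem normSq_mulVec_of_mem_unitaryGroup {N : ℕ} {U : Matrix (QReg N) (QReg N) ℂ}
    (hU : U ∈ Matrix.unitaryGroup (QReg N) ℂ) (ψ : QReg N → ℂ) :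
    normSq (U *ᵥ ψ) = normSq ψ := by
  have h : star (U *ᵥ ψ) ⬝ᵥ (U *ᵥ ψ) = star ψ ⬝ᵥ ψ := by
    rw [Matrix.star_mulVec, ← Matrix.dotProduct_mulVec, Matrix.mulVec_mulVec,
      ← star_eq_conjTranspose, Matrix.mem_unitaryGroup_iff'.1 hU, Matrix.one_mulVec]
  exact_mod_cast
    ((ofReal_normSq_eq_dotProduct _).trans h).trans (ofReal_normSq_eq_dotProduct ψ).symm

/-- The output state of a circuit over a unitary gate set run on a basis state `|x 0^m⟩` is a
unit vector. (Nielsen–Chuang 2010, §2.2.3, eq. (2.95): probabilities sum to one.) [folklore] -/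
theorem QCircuit.normSq_runOn_basisState (hG : G.IsUnitary) (A : Language Bool)
    (C : QCircuit G (n + m)) (x : QReg n) :
    normSq (C.runOn A (basisState (padInput x m))) = 1 := by
  rw [QCircuit.runOn, normSq_mulVec_of_mem_unitaryGroup
    (QCircuit.toMatrix_mem_unitaryGroup_holds hG A C), normSq_basisState]

/-- **Discharge of `QCircuit.outputPMF_apply`.** Over a unitary gate set the output distribution
of a circuit run on `|x⟩|0^m⟩` assigns to the outcome `y` exactly the squared amplitude
`|(U_C |x 0^m⟩)(y)|²`: the output state is a unit vector (`normSq_runOn_basisState`), so the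
normalising denominator of `bornPMF` is `1` (`bornPMF_apply_of_sum_eq_one`). This is the Born
rule for a computational-basis measurement, `p(y) = ⟨ψ|P_y|ψ⟩ = |⟨y|ψ⟩|²` with
`∑_y p(y) = 1` for a unit vector `ψ`. (Nielsen–Chuang 2010, §2.2.3 Postulate 3, eqs.
(2.92)–(2.95), PDF p. 131; §2.2.5, eq. (2.103), PDF p. 134.) [cite: NielsenChuang2010, §2.2.5 eq. (2.103)] -/
theorem QCircuit.outputPMF_apply_holds :
    QCircuit.outputPMF_apply (G := G) (n := n) (m := m) := by
  intro hG A C x y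
  unfold QCircuit.outputPMF
  exact bornPMF_apply_of_sum_eq_one (QCircuit.normSq_runOn_basisState hG A C x) y

/-- **Discharge of `QCircuit.acceptProb_le_one`.** Over a unitary gate set acceptance
probabilities are at most `1`: `acceptProb` is a sub-sum (over the outcomes with wire `0` set) of
the squared amplitudes of the output state, which sum to `1` (`normSq_runOn_basisState`).
(Nielsen–Chuang 2010, §2.2.3 Postulate 3, eq. (2.95), PDF p. 131: probabilities sum to one;
§2.2.5.) [cite: NielsenChuang2010, §2.2.5] -/
theorem QCircuit.acceptProb_le_one_holds :
    QCircuit.acceptProb_le_one (G := G) (n := n) (m := m) := by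
  intro hG A C x
  rw [← QCircuit.normSq_runOn_basisState hG A C x, QCircuit.acceptProb, normSq]
  refine Finset.sum_le_sum fun y _ => ?_
  split_ifs
  · exact le_rfl
  · positivity
  · positivity

/-! ### Uniform families are polynomial-size -/

section Uniform

open Polynomial Complexity Complexity.TM2Comp

variable [Encodable G.Op]

/-- The right-nested `boolPair` list of gate encodings underlying `QCircuit.encode` is at least as
long as the gate list: each gate contributes `boolPair g.encode ·`, i.e. at least the two
separator bits (`length_boolPair`). [folklore] -/
theorem QCircuit.length_le_length_foldr_boolPair (gs : List (QGate G n)) :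
    gs.length ≤ (gs.foldr (fun g acc => boolPair g.encode acc) []).length := by
  induction gs with
  | nil => exact le_rfl
  | cons g gs ih =>
    simp only [List.foldr_cons, List.length_cons, length_boolPair]
    omega

/-- **Every gate costs at least two bits of description**: `C.size ≤ |QCircuit.encode C|`.
(Arora–Barak 2009, §6.1: the size of a circuit is at most the length of its string
description.) [folklore] -/
theorem QCircuit.size_le_length_encode (C : QCircuit G n) : C.size ≤ C.encode.length :=
  QCircuit.length_le_length_foldr_boolPair C.gates

/-- The length of the description `sigmaEncode ⟨n, m, C⟩ = ⟨⌜n⌝₂, ⟨1^m, encode C⟩⟩`: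
`2·|⌜n⌝₂| + 2 + (2·m + 2 + |encode C|)` (`length_boolPair`; the ancilla count is unary,
`|1^m| = m`). [folklore] -/
theorem QCircuit.length_sigmaEncode (n m : ℕ) (C : QCircuit G (n + m)) :
    (QCircuit.sigmaEncode (G := G) ⟨n, m, C⟩).length =
      2 * (encodeNat n).length + 2 + (2 * m + 2 + C.encode.length) := by
  have hm : (unaryEncodeNat m).length = m := unary_decode_encode_nat m
  simp only [QCircuit.sigmaEncode, length_boolPair, hm]

/-- **The description of a circuit is at least as long as its size plus its ancilla count**:
`C.size + m ≤ |sigmaEncode ⟨n, m, C⟩|` (gates cost two bits each, `size_le_length_encode`; the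
`m` ancillas cost `2m` bits, being written in unary — the design choice recorded at
`QCircuit.sigmaEncode`, matching Nielsen–Chuang's requirement that the description of `C_n` list
"any ancilla bits needed by the circuit", §3.1.2, p. 134, and Arora–Barak's `m ≤ T(n)` in
Def. 10.9). [folklore] -/
theorem QCircuit.size_add_le_length_sigmaEncode (n m : ℕ) (C : QCircuit G (n + m)) :
    C.size + m ≤ (QCircuit.sigmaEncode (G := G) ⟨n, m, C⟩).length := by
  have h := C.size_le_length_encode
  rw [QCircuit.length_sigmaEncode]
  omega

/-- **A polynomial-time machine writes a polynomial-length output.** For a uniform family, the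
description `sigmaEncode ⟨n, ancillas n, circ n⟩` written by the uniformity machine `M` on input
`1ⁿ` within `p(n)` steps has length at most `n + D·p(n)`, `D = machinePushBound M.tm` (each TM2
step pushes at most `D` symbols, `Turing.TM2ComputableAux.OutputsWithin.length_le`); the bound is
the polynomial `X + C D * p`. This is the step "run `M(1^{|x|})` to obtain the circuit `C_{|x|}`"
of a polynomial-time computation in the proof of Arora–Barak Thm. 6.13 (P-uniform circuit
families, Def. 6.12), pp. 111–112.
[cite: AroraBarak2009, Def. 6.12 & Thm. 6.13 (proof) pp. 111–112] -/
theorem QCircuitFamily.IsUniform.exists_length_sigmaEncode_le {F : QCircuitFamily G}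
    (hF : F.IsUniform) :
    ∃ q : Polynomial ℕ, ∀ n,
      (QCircuit.sigmaEncode (G := G) ⟨n, F.ancillas n, F.circ n⟩).length ≤ q.eval n := by
  obtain ⟨p, M, hM⟩ := hF
  refine ⟨X + C (machinePushBound M.tm) * p, fun n => ?_⟩
  have h : (QCircuit.sigmaEncode (G := G) ⟨n, F.ancillas n, F.circ n⟩).length ≤
      (unaryEncodeNat n).length +
        machinePushBound M.tm * p.eval (unaryEncodeNat n).length :=
    (hM n).length_le
  have hn : (unaryEncodeNat n).length = n := unary_decode_encode_nat n
  rw [hn] at h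
  simpa only [eval_add, eval_X, eval_mul, eval_C] using h

/-- **Discharge of `QCircuitFamily.IsUniform.isPolySize`: uniform families are polynomial-size,
ancillas included.** If `1ⁿ ↦ ⟨n, ancillas n, circ n⟩` is computable in polynomial time (under
`QCircuit.sigmaEncode`), then for the polynomial `q = X + C D * p` of
`exists_length_sigmaEncode_le` both `(circ n).size ≤ q(n)` and `ancillas n ≤ q(n)`, because the
description written within `p(n)` steps has length `≤ q(n)` and is at least
`(circ n).size + ancillas n` bits long (`QCircuit.size_add_le_length_sigmaEncode`). This is the
observation behind Arora–Barak Def. 6.12/Thm. 6.13, pp. 111–112 (a **P**-uniform family is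
generated by "a polynomial-time TM that on input `1ⁿ` outputs the description of the circuit
`C_n`", so obtaining `C_{|x|}` is a polynomial-time — hence polynomial-output — computation) and
Def. 10.9 (BQP: a polynomial-time TM writes the gate list, `m ≤ T(n)` qubits); Nielsen–Chuang
§3.1.2, p. 134 and §4.5.5, pp. 200–201 (uniformly generated polynomial-size quantum circuit
families, after Yao 1993). [cite: AroraBarak2009, Def. 6.12 & Thm. 6.13 (proof) pp. 111–112] -/
theorem QCircuitFamily.IsUniform.isPolySize_holds :
    QCircuitFamily.IsUniform.isPolySize (G := G) := by
  intro F hF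
  obtain ⟨q, hq⟩ := hF.exists_length_sigmaEncode_le
  refine ⟨q, fun n => ?_⟩
  have h := (QCircuit.size_add_le_length_sigmaEncode n (F.ancillas n) (F.circ n)).trans (hq n)
  exact ⟨le_of_add_le_left h, le_of_add_le_right h⟩

/-- Applied form of `QCircuitFamily.IsUniform.isPolySize_holds`, with the fact unfolded: a
uniform family is polynomial-size (this is the term the dependents feed to their
`(h : IsUniform.isPolySize)` hypotheses).
[cite: AroraBarak2009, Def. 6.12 & Thm. 6.13 (proof) pp. 111–112] -/
theorem QCircuitFamily.IsUniform.isPolySize' {F : QCircuitFamily G} (hF : F.IsUniform) :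
    F.IsPolySize :=
  QCircuitFamily.IsUniform.isPolySize_holds hF

end Uniform

end Literature.Computability.Cryptography
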